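import Mathlib
import HarnessLib
import Summits.HodgeConjecture.HodgeConjecture.Theorems.EightfoldBlochSeedsBlochSpreadEightFourFlatFamilyFibreCodim
import Summits.HodgeConjecture.HodgeConjecture.Theorems.EightfoldBlochSeedsBlochSpreadEightFourFultonSupportStep
import Literature.AlgebraicGeometry.Resolution.PrimeDivisorIdeals
import Literature.AlgebraicGeometry.Resolution.FibreCoheightInequalitySharp
import Literature.AlgebraicGeometry.Resolution.DimensionFormula
import Literature.AlgebraicGeometry.Resolution.CohenMacaulayCatenary
import Literature.AlgebraicGeometry.Resolution.BlowupRelativeDimension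
import Literature.AlgebraicGeometry.Resolution.RegularLocalRingsProofs

/-!
# Maximal points of a flat family of closed subschemes have the codimension read on ONE fibre —
# item (F4′) of the Fulton gap inventory, and conclusion (1) of Fulton's fact for every supported class
# (crux `BlochSpreadEightFour`, stmt-HodgeConjecture-18884, line `bloch-lifts-fulton`, stub `stub_fultonSpecialises`)

HONEST FRAMING: helper file; no stub is closed and nothing here proves `BlochSpreadEightFour`, rung H2,
HC_AV or HC. Sequel of `…FultonSupportStep.lean` ((F3), gap inventory) and `…FlatFamilyFibreCodim.lean`
((F4)): it removes the hypothesis "every maximal point of `𝒲` has codimension `≥ p` in `𝒳`" of (F4) in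
favour of the binder of the fact itself — the codimension of the points of ONE fibre `𝒳_{v₀} ∩ 𝒲` — and
assembles conclusion (1) of `fulton1998_flatFamily_cycleClass_specialises` / of its slice `(RC)` for
EVERY global class supported on the flat family.

## What is proved (sorry-free; no definition, no named fact)

* `apply_eq_genericPoint_of_isMax_of_flat` — a maximal point maps to the generic point of an
  irreducible base under a flat morphism (flat ⇒ generalising).
* `exists_specializes_and_apply_eq_of_isMax_of_flat` — every irreducible component of a closed
  subscheme flat over an irreducible base meets every fibre of a universally closed ambient family.
* `coheight_eq_coheight_add_coheight_closure_of_isRegularLocalRing` — catenary bookkeeping at a point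
  with regular local ring: `codim x = codim ζ + codim_{cl ζ} x` for `ζ ⤳ x` (the tree's
  `isCatenaryRing_of_isRegularLocalRing`, `IsCatenaryRing.height_eq_height_add_height_map_quotientMk`,
  `coe_height_primeOfSpecializes`, `coheight_closure_eq_ringKrullDim_quotient`).
* `le_coheight_of_isMax_of_flat_family` — **(F4′)**: for `g : 𝒳 ⟶ V` flat and universally closed over a
  separated irreducible locally Noetherian `V`, regular local rings of `𝒳` along `𝒳_{v₀}`,
  `ι : 𝒲 ↪ 𝒳` closed with `ι ≫ g` flat, and "points of `𝒳_{v₀}` on `𝒲` have codimension `≥ p` in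
  `𝒳_{v₀}`": every maximal point of `𝒲` has codimension `≥ p` in `𝒳`. (Minimal-codimension point `x₀`
  of `cl(ι ξ) ∩ 𝒳_{v₀}`; catenarity at `x₀`; Matsumura 15.1 (i) with the sharp fibre term, the tree's
  `coheight_closure_le_add_coheight_fibre`, whose fibre term vanishes at `x₀`; Hartshorne III 9.5.)
* `forall_map_fiberι_mem_algebraicClasses_of_flat_family` — conclusion (1) for every class supported
  on `ι(𝒲)`: (F3) ∘ (F4) ∘ (F4′).

After this file the `(RC)` debt of the line is: EXISTENCE of a global class on `𝒳 ×_S V` supported on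
Bloch's flat lift `𝒵` with non-zero restriction to the central fibre ((F1) + non-vanishing (F5b)),
for the smooth projective family over the étale neighbourhood `V` (separatedness / irreducibility of
`V` are harmless there: restrict to an affine open neighbourhood of `v₀`, which is NOT done here).

References: [Hartshorne1977] III Prop. 9.5, Cor. 9.6, II Ex. 3.22; [Matsumura1987] Thm. 15.1 (i),
Thm. 17.4 (ii), §5 p. 31; [Fulton1998] §10.1 Prop. 10.1 (a), §19.1 eq. (1); [StacksProject] Tags
01J7, 02IZ, 00OM.
-/

-- every declaration of this problem lives in `Summit.HodgeConjecture.HodgeConjecture.…` (summit = sub-problem)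
set_option linter.dupNamespace false

noncomputable section

open CategoryTheory CategoryTheory.Limits AlgebraicGeometry Order
open Literature.AlgebraicGeometry.Motives Literature.AlgebraicGeometry.HodgeTheory
open Literature.AlgebraicGeometry.Resolution IsLocalRing

namespace Summit.HodgeConjecture.HodgeConjecture.Theorems

/-- A maximal point of `W` (for the specialisation order `a ≤ b ↔ b ⤳ a`: a point with no proper
generisation) maps, under a FLAT morphism `W ⟶ V` to an irreducible scheme, to the generic point of `V`
(flat morphisms are generalising, Mathlib `Flat.generalizingMap`). [folklore] -/
theorem apply_eq_genericPoint_of_isMax_of_flat {W V : Scheme} (f : W ⟶ V) [Flat f] [IrreducibleSpace V]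
    {ξ : W} (hξ : IsMax ξ) : f.base ξ = genericPoint V := by
  obtain ⟨ξ', hξ'ξ, hξ'η⟩ := Flat.generalizingMap f (genericPoint_specializes (f.base ξ))
  have h1 : ξ ⤳ ξ' := Scheme.le_iff_specializes.1 (hξ (Scheme.le_iff_specializes.2 hξ'ξ))
  have : ξ' = ξ := (hξ'ξ.antisymm h1).eq
  rw [← this]
  exact hξ'η

/-- **Every irreducible component of a closed subscheme FLAT over an irreducible base meets every fibre
of a universally closed ambient family.** For `ι : W ⟶ X` (any morphism), `g : X ⟶ V` universally
closed, `ι ≫ g` flat, `V` irreducible and `ξ` a maximal point of `W`: the closure of `ι ξ` meets the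
fibre of `g` over every point `v` of `V` (it maps onto a closed set containing the generic point).
[cite: Hartshorne1977, III Prop. 9.5 and Cor. 9.6 (context); II Ex. 3.22] -/
theorem exists_specializes_and_apply_eq_of_isMax_of_flat {W X V : Scheme} (ι : W ⟶ X) (g : X ⟶ V)
    [UniversallyClosed g] [Flat (ι ≫ g)] [IrreducibleSpace V] {ξ : W} (hξ : IsMax ξ) (v : V) :
    ∃ x : X, ι.base ξ ⤳ x ∧ g.base x = v := by
  have hη : g.base (ι.base ξ) = genericPoint V := by
    rw [← Scheme.Hom.comp_apply]
    exact apply_eq_genericPoint_of_isMax_of_flat (ι ≫ g) hξ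
  have hclosed : IsClosed (g.base '' closure {ι.base ξ}) := g.isClosedMap _ isClosed_closure
  have huniv : g.base '' closure {ι.base ξ} = Set.univ := by
    apply Set.eq_univ_of_univ_subset
    rw [← genericPoint_closure (V : Type _)]
    exact hclosed.closure_subset_iff.2
      (Set.singleton_subset_iff.2 ⟨ι.base ξ, subset_closure rfl, hη⟩)
  obtain ⟨x, hx, hxv⟩ := (Set.eq_univ_iff_forall.1 huniv) v
  exact ⟨x, specializes_iff_mem_closure.2 hx, hxv⟩

/-- **Catenary bookkeeping at a point.** For `ζ ⤳ x` in a scheme whose local ring at `x` is a regular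
local ring (hence catenary): `codim x = codim ζ + codim_{cl ζ} x`. [cite: Matsumura1987, Thm. 17.4 (ii) and §5 p. 31] -/
theorem coheight_eq_coheight_add_coheight_closure_of_isRegularLocalRing {X : Scheme} {ζ x : X}
    (h : ζ ⤳ x) [IsRegularLocalRing (X.presheaf.stalk x)] :
    coheight x = coheight ζ +
      coheight (⟨x, specializes_iff_mem_closure.mp h⟩ : ↥(closure ({ζ} : Set X))) := by
  set A := X.presheaf.stalk x with hA
  set P : Ideal A := primeOfSpecializes h with hP
  have hcat : IsCatenaryRing A := isCatenaryRing_of_isRegularLocalRing A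
  haveI : IsDomain A := isDomain_of_isRegularLocalRing A
  have hPm : P ≤ maximalIdeal A := IsLocalRing.le_maximalIdeal (Ideal.IsPrime.ne_top inferInstance)
  have key := hcat.height_eq_height_add_height_map_quotientMk hPm
  -- `ht 𝔪 = codim x`
  have h1 : (((maximalIdeal A).height : ℕ∞) : WithBot ℕ∞) = coheight x := by
    rw [IsLocalRing.maximalIdeal_height_eq_ringKrullDim, hA, ringKrullDim_stalk_eq_coheight]
  -- `ht 𝔭_ζ = codim ζ`
  have h2 : ((P.height : ℕ∞) : WithBot ℕ∞) = coheight ζ := coe_height_primeOfSpecializes h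
  -- `ht (𝔪/𝔭_ζ) = codim_{cl ζ} x`
  haveI : Nontrivial (A ⧸ P) := Ideal.Quotient.nontrivial_iff.mpr (Ideal.IsPrime.ne_top inferInstance)
  haveI : IsLocalRing (A ⧸ P) :=
    IsLocalRing.of_surjective' (Ideal.Quotient.mk P) Ideal.Quotient.mk_surjective
  have h3 : ((((maximalIdeal A).map (Ideal.Quotient.mk P)).height : ℕ∞) : WithBot ℕ∞) =
      coheight (⟨x, specializes_iff_mem_closure.mp h⟩ : ↥(closure ({ζ} : Set X))) := by
    rw [map_maximalIdeal_of_surjective (Ideal.Quotient.mk P) Ideal.Quotient.mk_surjective,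
      IsLocalRing.maximalIdeal_height_eq_ringKrullDim, coheight_closure_eq_ringKrullDim_quotient h]
  have h1' : (maximalIdeal A).height = coheight x := by exact_mod_cast h1
  have h2' : P.height = coheight ζ := by exact_mod_cast h2
  have h3' : ((maximalIdeal A).map (Ideal.Quotient.mk P)).height =
      coheight (⟨x, specializes_iff_mem_closure.mp h⟩ : ↥(closure ({ζ} : Set X))) := by
    exact_mod_cast h3
  rw [← h1', ← h2', ← h3']
  exact key

/-- **(F4′) Maximal points of a flat family have codimension `≥ p` in the total space, from the
fibre binder at ONE point.** Let `g : 𝒳 ⟶ V` be flat and universally closed over a separated,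
irreducible, locally Noetherian `V`, with regular local rings along the fibre over `v₀ ∈ V(ℂ)`;
`ι : 𝒲 ↪ 𝒳` a closed immersion with `ι ≫ g` flat; and suppose every point of the fibre
`𝒳_{v₀} = Motives.fiberOver g v₀` lying on `𝒲` has codimension `≥ p` in `𝒳_{v₀}`. Then every maximal
point `ξ` of `𝒲` has codimension `≥ p` in `𝒳`. PROOF: `cl(ι ξ)` meets `𝒳_{v₀}`
(`exists_specializes_and_apply_eq_of_isMax_of_flat`); at a point `x₀` of `cl(ι ξ) ∩ 𝒳_{v₀}` of minimal
codimension, catenarity of the regular `𝒪_{𝒳,x₀}` gives `codim x₀ = codim (ι ξ) + codim_{cl ι ξ} x₀`,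
Matsumura 15.1 (i) with the sharp fibre term (`coheight_closure_le_add_coheight_fibre`) gives
`codim_{cl ι ξ} x₀ ≤ codim_V v₀ + 0`, and Hartshorne III 9.5 for the flat `g` gives
`codim x₀ = codim_V v₀ + codim_{𝒳_{v₀}} x₀ ≥ codim_V v₀ + p`.
[cite: Hartshorne1977, III Prop. 9.5] [cite: Matsumura1987, Thm. 15.1 and Thm. 17.4 (ii)] -/
theorem le_coheight_of_isMax_of_flat_family {𝒳 V : SchemeOver ℂ} (g : 𝒳 ⟶ V)
    [IsSeparated V.hom] [Flat g.left] [UniversallyClosed g.left] [IsLocallyNoetherian 𝒳.left]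
    [IsLocallyNoetherian V.left] [IrreducibleSpace V.left]
    {𝒲 : Scheme} (ι : 𝒲 ⟶ 𝒳.left) [IsClosedImmersion ι] [Flat (ι ≫ g.left)]
    (v₀ : ComplexPoints V)
    (hXreg : ∀ x : 𝒳.left, g.left.base x = v₀.pt → IsRegularLocalRing (𝒳.left.presheaf.stalk x))
    {p : ℕ} (hcodim : ∀ z : (fiberOver g v₀).left,
      (fiberι g v₀).left.base z ∈ Set.range ι.base → (p : ℕ∞) ≤ coheight z)
    (ξ : 𝒲) (hξ : IsMax ξ) : (p : ℕ∞) ≤ coheight (ι.base ξ) := by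
  classical
  -- points of `cl(ι ξ)` over `v₀`, with their (finite) codimensions
  have hS : ∃ n : ℕ, ∃ x : 𝒳.left, ι.base ξ ⤳ x ∧ g.left.base x = v₀.pt ∧ coheight x = n := by
    obtain ⟨x, hx, hxv⟩ := exists_specializes_and_apply_eq_of_isMax_of_flat ι g.left hξ v₀.pt
    obtain ⟨n, hn⟩ := ENat.ne_top_iff_exists.mp (coheight_lt_top_of_isLocallyNoetherian x).ne
    exact ⟨n, x, hx, hxv, hn.symm⟩
  -- one of minimal codimension, `x₀`
  obtain ⟨x₀, hx₀, hx₀v, hx₀n⟩ := Nat.find_spec hS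
  have hmin : ∀ y : 𝒳.left, ι.base ξ ⤳ y → y ⤳ x₀ → g.left.base y = v₀.pt → y = x₀ := by
    intro y hy hyx hyv
    by_contra hne
    have hlt : x₀ < y := by
      refine lt_iff_le_not_ge.2 ⟨Scheme.le_iff_specializes.2 hyx, fun hle => hne ?_⟩
      exact (hyx.antisymm (Scheme.le_iff_specializes.1 hle)).eq
    have hfin := coheight_lt_top_of_isLocallyNoetherian y
    have hlt' := coheight_strictAnti hlt hfin
    obtain ⟨m, hm⟩ := ENat.ne_top_iff_exists.mp hfin.ne
    have hmn : m < Nat.find hS := by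
      rw [← hm, hx₀n] at hlt'
      exact_mod_cast hlt'
    exact Nat.find_min hS hmn ⟨y, hy, hyv, hm.symm⟩
  -- catenarity at `x₀`: `codim x₀ = codim (ι ξ) + codim_{cl ι ξ} x₀`
  haveI := hXreg x₀ hx₀v
  have hcat := coheight_eq_coheight_add_coheight_closure_of_isRegularLocalRing hx₀
  -- Matsumura 15.1 (i), sharp fibre term
  have hsharp := coheight_closure_le_add_coheight_fibre g.left hx₀
  have hfib : coheight (⟨x₀, ⟨specializes_iff_mem_closure.mp hx₀, rfl⟩⟩ :
      ↥(closure ({ι.base ξ} : Set 𝒳.left) ∩ g.left.base ⁻¹' {g.left.base x₀})) = 0 := by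
    rw [coheight_eq_zero]
    intro y hy
    have hyx : (y : 𝒳.left) ⤳ x₀ := Scheme.le_iff_specializes.1 hy
    have hy1 : ι.base ξ ⤳ (y : 𝒳.left) := specializes_iff_mem_closure.2 y.2.1
    have hy2 : g.left.base y = v₀.pt := by rw [← hx₀v]; exact y.2.2
    have heq := hmin y hy1 hyx hy2
    apply Scheme.le_iff_specializes.2
    rw [heq]
  have hbase : coheight (⟨g.left.base x₀, specializes_iff_mem_closure.mp (hx₀.map g.left.continuous)⟩ :
      ↥(closure ({g.left.base (ι.base ξ)} : Set V.left))) ≤ coheight (g.left.base x₀) :=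
    coheight_le_coheight_apply_of_strictMono
      (fun v : ↥(closure ({g.left.base (ι.base ξ)} : Set V.left)) => (v : V.left))
      (Subtype.strictMono_coe _) _
  rw [hfib, add_zero] at hsharp
  have hb : coheight (⟨x₀, specializes_iff_mem_closure.mp hx₀⟩ : ↥(closure ({ι.base ξ} : Set 𝒳.left))) ≤
      coheight v₀.pt := by
    rw [← hx₀v]; exact hsharp.trans hbase
  -- Hartshorne III 9.5 at `x₀`, read in the tree's fibre
  obtain ⟨e, he⟩ := exists_iso_fiberOver_fiber g v₀
  set y₀ : ↥(g.left.fiber v₀.pt) := (g.left.fiberHomeo v₀.pt).symm ⟨x₀, hx₀v⟩ with hy₀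
  have hy₀x : (g.left.fiberι v₀.pt).base y₀ = x₀ := g.left.fiberι_fiberHomeo_symm _ _
  have hH := coheight_eq_coheight_add_coheight_of_fiberι_eq g.left y₀ hy₀x
  have hz₀x : (fiberι g v₀).left.base (e.inv.base y₀) = x₀ := by
    rw [← he, ← Scheme.Hom.comp_apply, e.inv_hom_id_assoc, hy₀x]
  have hzy : coheight (e.inv.base y₀) = coheight y₀ := coheight_eq_of_isOpenImmersion e.inv
  have hx₀range : x₀ ∈ Set.range ι.base :=
    ι.isClosedEmbedding.isClosed_range.closure_subset_iff.2
      (Set.singleton_subset_iff.2 ⟨ξ, rfl⟩) (specializes_iff_mem_closure.1 hx₀)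
  have hpz : (p : ℕ∞) ≤ coheight y₀ := by
    rw [← hzy]
    exact hcodim _ (by rw [hz₀x]; exact hx₀range)
  -- arithmetic in `ℕ∞`
  have hr : coheight v₀.pt ≠ ⊤ := (coheight_lt_top_of_isLocallyNoetherian _).ne
  have key : coheight v₀.pt + (p : ℕ∞) ≤ coheight v₀.pt + coheight (ι.base ξ) :=
    calc coheight v₀.pt + (p : ℕ∞) ≤ coheight v₀.pt + coheight y₀ := by gcongr
      _ = coheight x₀ := hH.symm
      _ = coheight (ι.base ξ) + coheight (⟨x₀, specializes_iff_mem_closure.mp hx₀⟩ :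
            ↥(closure ({ι.base ξ} : Set 𝒳.left))) := hcat
      _ ≤ coheight (ι.base ξ) + coheight v₀.pt := by gcongr
      _ = coheight v₀.pt + coheight (ι.base ξ) := add_comm _ _
  exact (WithTop.add_le_add_iff_left hr).mp key

/-- **Conclusion (1) of Fulton's fact / of `(RC)` for ANY class supported on the flat family.** Under the
hypotheses of `le_coheight_of_isMax_of_flat_family` (flat, universally closed `g : 𝒳 ⟶ V` over a
separated irreducible locally Noetherian `V`, regular local rings of `𝒳` along `𝒳_{v₀}`, `ι : 𝒲 ↪ 𝒳`
closed with `ι ≫ g` flat, and the fibre binder "points of `𝒳_{v₀}` on `𝒲` have codimension `≥ p`"),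
EVERY global class `Γ ∈ H²ᵖ(𝒳(ℂ); ℂ)` supported on `ι(𝒲)` has algebraic fibre restrictions
`Γ|_{𝒳_t} ∈ algebraicClasses (𝒳_t) p` at every `t ∈ V(ℂ)` — the support step
(`forall_map_fiberι_mem_algebraicClasses_of_mem_classesSupportedOn`, (F3)) fed by (F4)
(`le_coheight_of_mem_range_of_flat_family`) and (F4′). What remains of `(RC)` after this is only the
EXISTENCE of a global class supported on the flat family with non-zero central restriction ((F1) and
the non-vanishing half of (F5) of the gap inventory).
[cite: Fulton1998, §10.1 Prop. 10.1 (a); §19.1 eq. (1)] [cite: Hartshorne1977, III Prop. 9.5] -/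
theorem forall_map_fiberι_mem_algebraicClasses_of_flat_family {𝒳 V : SchemeOver ℂ} (g : 𝒳 ⟶ V)
    [IsSeparated V.hom] [Flat g.left] [UniversallyClosed g.left] [IsLocallyNoetherian 𝒳.left]
    [IsLocallyNoetherian V.left] [IrreducibleSpace V.left]
    {𝒲 : Scheme} (ι : 𝒲 ⟶ 𝒳.left) [IsClosedImmersion ι] [Flat (ι ≫ g.left)] [IsLocallyNoetherian 𝒲]
    (v₀ : ComplexPoints V)
    (hXreg : ∀ x : 𝒳.left, g.left.base x = v₀.pt → IsRegularLocalRing (𝒳.left.presheaf.stalk x))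
    {p : ℕ} (hcodim : ∀ z : (fiberOver g v₀).left,
      (fiberι g v₀).left.base z ∈ Set.range ι.base → (p : ℕ∞) ≤ coheight z)
    {Γ : complexBetti 𝒳 (2 * p)} (hΓ : Γ ∈ classesSupportedOn 𝒳 (Set.range ι.base) (2 * p)) :
    ∀ t : ComplexPoints V,
      complexBetti.map (fiberι g t) (2 * p) Γ ∈ algebraicClasses (fiberOver g t) p :=
  forall_map_fiberι_mem_algebraicClasses_of_mem_classesSupportedOn g
    ι.isClosedEmbedding.isClosed_range hΓ
    (fun t z hz => le_coheight_of_mem_range_of_flat_family g ι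
      (le_coheight_of_isMax_of_flat_family g ι v₀ hXreg hcodim) t z hz)

end Summit.HodgeConjecture.HodgeConjecture.Theorems

end
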